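import Summits.CriticalPhenomena.PercolationContinuityZ3.Theorems.PercLowPointHalfSpaceQuantitativeBGNWallTwoGhostMTP
import HarnessLib

/-!
# `QuantitativeBGN` (stmt-CriticalPhenomena-0913), line `longrange-wall-ghost-bootstrap` — K1, Lemma 3.1 and Cauchy–Schwarz

Part of the stub `stub_wallTwoGhost` (K1, basic two-ghost inequality on the wall; template
`Literature/Probability/Percolation/TwoGhostInequalityProofs.lean`, Steps 3–4). Namespace
`…Theorems.WallTwoGhost`:

* **Steps 1–3 combined** (`sum_lintegral_Tgt_le`): summing Step 1 over the weighted bonds of types `s` at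
  `0` and transporting (Step 2), `Σ_{x∈s} c_x q_x E[Tgt_x] ≤ E[VwH(0) |Z^c|]` — pointwise
  `Σ c q #closed = Σ c (1-q) #open - Z^c`, and the `N^op`-mass is finite so it cancels in `ℝ≥0∞`;
* **Step 4** (`lintegral_F4_sq_le`, registered as `wallTwoGhost_cauchy_schwarz`): with
  `F = 1(C_H(0) finite) min(1/n, 1/F) |Z^c| ≥ VwH(0) |Z^c|` (`Mabs_le`: `w(F)/F ≤ min(1/n,1/F)`),
  `(E F)² ≤ E F² ≤ 4V_c Σ_{t≥1} min(1/n², 1/t²) ≤ 8 V_c / n` by Cauchy–Schwarz, the summation by parts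
  `TwoGhost.lintegral_weight_le` against the second-moment bound of `…WallTwoGhostFatou.lean`, and
  `TwoGhost.tsum_min_inv_sq_le`.
-/

noncomputable section

namespace Summit.CriticalPhenomena.PercolationContinuityZ3.Theorems

open MeasureTheory Filter Literature.Probability.Percolation Literature.Probability.LatticeModels
open Summit.CriticalPhenomena.PercolationContinuityZ3.Theorems.WallGhost
open scoped ENNReal

namespace WallTwoGhost
/-! ### Step 3 (continued): from the transport identity to `|Z^c|` -/

section Combine2

open TwoGhost

/-- Pointwise, on a finite `C_H(0)`: `Σ_x c_x q_x #closed_x ≤ Σ_x c_x (1-q_x) #open_x + |Z^c|`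
(`#all = #open + #closed`, so the difference of the two sides is exactly `-Z^c`). [folklore] -/
theorem sum_closed_le (p : unitInterval) (lam α : ℝ) {c : Site 3 → ℝ} {s : Finset (Site 3)} (hc : ∀ x ∈ s, 0 ≤ c x)
    {ω : BondConfig (Site 3)} (hf : (clusterH ω 0).Finite) :
    ∑ x ∈ s, ENNReal.ofReal (c x * wallBondProb p lam α x) * (nSt false ω x : ℝ≥0∞) ≤
      ∑ x ∈ s, ENNReal.ofReal (c x * (1 - wallBondProb p lam α x)) * (nSt true ω x : ℝ≥0∞) +
        ENNReal.ofReal |Zc p lam α c s ω| := by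
  have hq0 : ∀ x, 0 ≤ wallBondProb p lam α x := fun x => (wallBondProb_mem p lam α x).1
  have hq1 : ∀ x, wallBondProb p lam α x ≤ 1 := fun x => (wallBondProb_mem p lam α x).2
  have e1 : ∑ x ∈ s, ENNReal.ofReal (c x * wallBondProb p lam α x) * (nSt false ω x : ℝ≥0∞) =
      ENNReal.ofReal (∑ x ∈ s, c x * wallBondProb p lam α x * nSt false ω x) := by
    rw [ENNReal.ofReal_sum_of_nonneg fun x hx => mul_nonneg (mul_nonneg (hc x hx) (hq0 x)) (Nat.cast_nonneg _)]
    refine Finset.sum_congr rfl fun x hx => ?_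
    rw [ENNReal.ofReal_mul (mul_nonneg (hc x hx) (hq0 x)), ENNReal.ofReal_natCast]
  have e2 : ∑ x ∈ s, ENNReal.ofReal (c x * (1 - wallBondProb p lam α x)) * (nSt true ω x : ℝ≥0∞) =
      ENNReal.ofReal (∑ x ∈ s, c x * (1 - wallBondProb p lam α x) * nSt true ω x) := by
    rw [ENNReal.ofReal_sum_of_nonneg fun x hx => mul_nonneg (mul_nonneg (hc x hx) (sub_nonneg.2 (hq1 x))) (Nat.cast_nonneg _)]
    refine Finset.sum_congr rfl fun x hx => ?_
    rw [ENNReal.ofReal_mul (mul_nonneg (hc x hx) (sub_nonneg.2 (hq1 x))), ENNReal.ofReal_natCast]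
  have hZ : Zc p lam α c s ω = ∑ x ∈ s, c x * (1 - wallBondProb p lam α x) * nSt true ω x -
      ∑ x ∈ s, c x * wallBondProb p lam α x * nSt false ω x := by
    rw [Zc, ← Finset.sum_sub_distrib]
    refine Finset.sum_congr rfl fun x _ => ?_
    rw [← nSt_true_add_false hf x]
    push_cast
    ring
  rw [e1, e2, ← ENNReal.ofReal_add (Finset.sum_nonneg fun x hx =>
    mul_nonneg (mul_nonneg (hc x hx) (sub_nonneg.2 (hq1 x))) (Nat.cast_nonneg _)) (abs_nonneg _)]
  refine ENNReal.ofReal_le_ofReal ?_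
  have := neg_abs_le (Zc p lam α c s ω)
  linarith

/-- **Steps 1–3 combined** (Hutchcroft 2020, Lemma 3.1 on the wall, ghost field integrated out, summed
over the weighted bonds of types `s` at `0`):
`Σ_{x∈s} c_x q_x E[Tgt_x] ≤ E[VwH(0) |Z^c|]`. [cite: Hutchcroft2020Locality, §3, proof of Lemma 3.1] -/
theorem sum_lintegral_Tgt_le (p : unitInterval) (lam α : ℝ) (n : ℕ) {c : Site 3 → ℝ} {s : Finset (Site 3)}
    (hs : ∀ x ∈ s, x 0 = 0 ∧ x ≠ 0) (hc : ∀ x ∈ s, 0 ≤ c x) (hq : ∀ x ∈ s, 0 < wallBondProb p lam α x) :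
    ∑ x ∈ s, ENNReal.ofReal (c x * wallBondProb p lam α x) * ∫⁻ ω, Tgt n x ω ∂(augWall p lam α) ≤
      ∫⁻ ω, VwH n ω 0 * ENNReal.ofReal |Zc p lam α c s ω| ∂(augWall p lam α) := by
  set P := augWall p lam α with hP
  set q : Site 3 → ℝ := fun x => wallBondProb p lam α x with hqdef
  have hq1 : ∀ x, q x ≤ 1 := fun x => (wallBondProb_mem p lam α x).2
  set Bp : Site 3 → ℝ≥0∞ := fun x => ∫⁻ ω, VwH n ω 0 * (nSt true ω x : ℝ≥0∞) ∂P with hBp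
  set Bm : Site 3 → ℝ≥0∞ := fun x => ∫⁻ ω, VwH n ω 0 * (nSt false ω x : ℝ≥0∞) ∂P with hBm
  -- Step 1 and Step 2 at each type, multiplied by `c_x q_x`
  have h1 : ∀ x ∈ s, ENNReal.ofReal (c x * q x) * ∫⁻ ω, Tgt n x ω ∂P + ENNReal.ofReal (c x * (1 - q x)) * Bp x ≤
      ENNReal.ofReal (c x * q x) * Bm x := by
    intro x hx
    obtain ⟨hx0, hxne⟩ := hs x hx
    have hxH : 0 ≤ x 0 := le_of_eq hx0.symm
    have h := lintegral_Tgt_add_le p lam α n hxH hxne (hq x hx)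
    have eop : ∫⁻ ω, Nop n x ω ∂P = Bp x := by
      simp only [hBp]
      rw [← lintegral_stEv_NN_eq p lam α true n hx0]
      exact lintegral_congr fun ω => Nop_eq n hxH hxne ω
    have ecl : ∫⁻ ω, Ncl n x ω ∂P = Bm x := by
      simp only [hBm]
      rw [← lintegral_stEv_NN_eq p lam α false n hx0]
      exact lintegral_congr fun ω => Ncl_eq n x ω
    rw [eop, ecl] at h
    change ∫⁻ ω, Tgt n x ω ∂P + ENNReal.ofReal ((1 - q x) / q x) * Bp x ≤ Bm x at h
    have h' : ENNReal.ofReal (c x * q x) * (∫⁻ ω, Tgt n x ω ∂P + ENNReal.ofReal ((1 - q x) / q x) * Bp x) ≤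
        ENNReal.ofReal (c x * q x) * Bm x := mul_le_mul' le_rfl h
    rw [mul_add, ← mul_assoc, ← ENNReal.ofReal_mul (mul_nonneg (hc x hx) (hq x hx).le)] at h'
    have hqx : q x ≠ 0 := (hq x hx).ne'
    have e : c x * q x * ((1 - q x) / q x) = c x * (1 - q x) := by
      field_simp
    rwa [e] at h'
  have hsum : ∑ x ∈ s, ENNReal.ofReal (c x * q x) * ∫⁻ ω, Tgt n x ω ∂P + ∑ x ∈ s, ENNReal.ofReal (c x * (1 - q x)) * Bp x ≤
      ∑ x ∈ s, ENNReal.ofReal (c x * q x) * Bm x := by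
    rw [← Finset.sum_add_distrib]; exact Finset.sum_le_sum h1
  -- the two `B`-sums as integrals of `VwH(0) · P±`
  have hmT : ∀ b x, Measurable fun ω : BondConfig (Site 3) => VwH n ω 0 * (nSt b ω x : ℝ≥0∞) := fun b x =>
    (measurable_VwH n 0).mul ((measurable_from_nat (f := fun k : ℕ => (k : ℝ≥0∞))).comp (measurable_nSt b x))
  have eP : ∑ x ∈ s, ENNReal.ofReal (c x * (1 - q x)) * Bp x =
      ∫⁻ ω, VwH n ω 0 * ∑ x ∈ s, ENNReal.ofReal (c x * (1 - q x)) * (nSt true ω x : ℝ≥0∞) ∂P := by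
    simp only [hBp]
    rw [Finset.sum_congr rfl fun x _ => (lintegral_const_mul _ (hmT true x)).symm,
      ← lintegral_finsetSum' _ fun x _ => ((hmT true x).const_mul _).aemeasurable]
    refine lintegral_congr fun ω => ?_
    rw [Finset.mul_sum]
    exact Finset.sum_congr rfl fun x _ => by ring
  have eM : ∑ x ∈ s, ENNReal.ofReal (c x * q x) * Bm x =
      ∫⁻ ω, VwH n ω 0 * ∑ x ∈ s, ENNReal.ofReal (c x * q x) * (nSt false ω x : ℝ≥0∞) ∂P := by
    simp only [hBm]
    rw [Finset.sum_congr rfl fun x _ => (lintegral_const_mul _ (hmT false x)).symm,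
      ← lintegral_finsetSum' _ fun x _ => ((hmT false x).const_mul _).aemeasurable]
    refine lintegral_congr fun ω => ?_
    rw [Finset.mul_sum]
    exact Finset.sum_congr rfl fun x _ => by ring
  -- pointwise comparison `VwH(0) P⁻ ≤ VwH(0) P⁺ + VwH(0) |Z|`
  have hpt : ∀ ω, VwH n ω 0 * ∑ x ∈ s, ENNReal.ofReal (c x * q x) * (nSt false ω x : ℝ≥0∞) ≤
      VwH n ω 0 * ∑ x ∈ s, ENNReal.ofReal (c x * (1 - q x)) * (nSt true ω x : ℝ≥0∞) +
        VwH n ω 0 * ENNReal.ofReal |Zc p lam α c s ω| := by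
    intro ω
    by_cases hf : (clusterH ω 0).Finite
    · rw [← mul_add]; exact mul_le_mul' le_rfl (sum_closed_le p lam α hc hf)
    · rw [VwH_of_neg (fun h => hf h.2)]; simp
  have hmP : Measurable fun ω : BondConfig (Site 3) => VwH n ω 0 * ∑ x ∈ s, ENNReal.ofReal (c x * (1 - q x)) * (nSt true ω x : ℝ≥0∞) :=
    (measurable_VwH n 0).mul (Finset.measurable_sum _ fun x _ =>
      ((measurable_from_nat (f := fun k : ℕ => (k : ℝ≥0∞))).comp (measurable_nSt true x)).const_mul _)
  -- finiteness of the `P⁺`-mass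
  have hfin : ∫⁻ ω, VwH n ω 0 * ∑ x ∈ s, ENNReal.ofReal (c x * (1 - q x)) * (nSt true ω x : ℝ≥0∞) ∂P ≠ ∞ := by
    rw [← eP]
    refine ENNReal.sum_ne_top.2 fun x hx => ENNReal.mul_ne_top ENNReal.ofReal_ne_top ?_
    refine ne_top_of_le_ne_top ENNReal.one_ne_top ?_
    calc Bp x ≤ ∫⁻ _, 1 ∂P := lintegral_mono fun ω => VwH_mul_nSt_true_le_one n (hs x hx).1 (hs x hx).2 ω
      _ = 1 := by rw [lintegral_const, measure_univ, mul_one]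
  have key : ∑ x ∈ s, ENNReal.ofReal (c x * q x) * ∫⁻ ω, Tgt n x ω ∂P +
      ∫⁻ ω, VwH n ω 0 * ∑ x ∈ s, ENNReal.ofReal (c x * (1 - q x)) * (nSt true ω x : ℝ≥0∞) ∂P ≤
      ∫⁻ ω, VwH n ω 0 * ENNReal.ofReal |Zc p lam α c s ω| ∂P +
        ∫⁻ ω, VwH n ω 0 * ∑ x ∈ s, ENNReal.ofReal (c x * (1 - q x)) * (nSt true ω x : ℝ≥0∞) ∂P := by
    calc _ ≤ ∑ x ∈ s, ENNReal.ofReal (c x * q x) * Bm x := by rw [← eP]; exact hsum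
      _ = _ := eM
      _ ≤ ∫⁻ ω, (VwH n ω 0 * ∑ x ∈ s, ENNReal.ofReal (c x * (1 - q x)) * (nSt true ω x : ℝ≥0∞) +
            VwH n ω 0 * ENNReal.ofReal |Zc p lam α c s ω|) ∂P := lintegral_mono hpt
      _ = _ := by rw [lintegral_add_left hmP, add_comm]
  exact ENNReal.le_of_add_le_add_right hfin key

end Combine2


/-! ### Step 4: Cauchy–Schwarz and summation by parts (proof of Thm. 1.6, (3.7)–(3.8)) -/

section Step4

open TwoGhost

variable (p : unitInterval) (lam α : ℝ)

open Classical in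
/-- The Cauchy–Schwarz integrand `F = 1(C_H(0) finite) b(F) |Z^c|`, `b(t) = min(1/n, 1/t)`.
[cite: Hutchcroft2020Locality, §3, proof of Thm. 1.6] -/
def F4 (n : ℕ) (c : Site 3 → ℝ) (s : Finset (Site 3)) (ω : BondConfig (Site 3)) : ℝ≥0∞ :=
  if (clusterH ω 0).Finite then bwt n (footN ω 0) * ENNReal.ofReal |Zc p lam α c s ω| else 0

/-- `F` is measurable. [folklore] -/
theorem measurable_F4 (n : ℕ) (c : Site 3 → ℝ) (s : Finset (Site 3)) : Measurable (F4 p lam α n c s) := by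
  classical
  unfold F4
  refine Measurable.ite (measurableSet_finite_clusterH 0) ?_ measurable_const
  exact ((measurable_from_nat (f := bwt n)).comp (measurable_footN 0)).mul
    (ENNReal.measurable_ofReal.comp (continuous_abs.measurable.comp (measurable_Zc p lam α c s)))

/-- `w(t)/t ≤ min(1/n, 1/t)` for `t, n ≥ 1` (`w ≤ 1`, `w(t) ≤ t/n`). [folklore] -/
theorem wt_div_le' {n t : ℕ} (hn : 1 ≤ n) (ht : 1 ≤ t) : wt n t / t ≤ min (1 / (n : ℝ)) (1 / (t : ℝ)) := by
  have ht0 : (0 : ℝ) < t := by exact_mod_cast ht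
  have hn0 : (0 : ℝ) < n := by exact_mod_cast hn
  refine le_min ?_ ?_
  · calc wt n t / t ≤ ((t : ℝ) / n) / t := div_le_div_of_nonneg_right (wt_le_div n t) ht0.le
      _ = 1 / (n : ℝ) := by field_simp
  · exact div_le_div_of_nonneg_right (wt_le_one n t) ht0.le

/-- **`VwH(0) |Z^c| ≤ F`** pointwise (`n ≥ 1`): `w(F)/F ≤ min(1/n, 1/F)`.
[cite: Hutchcroft2020Locality, §3, proof of Thm. 1.6] -/
theorem Mabs_le {n : ℕ} (hn : 1 ≤ n) (c : Site 3 → ℝ) (s : Finset (Site 3)) (ω : BondConfig (Site 3)) :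
    VwH n ω 0 * ENNReal.ofReal |Zc p lam α c s ω| ≤ F4 p lam α n c s ω := by
  by_cases hf : (clusterH ω 0).Finite
  · rw [VwH_of_pos rfl hf, F4, if_pos hf]
    refine mul_le_mul' ?_ le_rfl
    have hF : 1 ≤ footN ω 0 := one_le_footN rfl hf
    have hF0 : (0 : ℝ) < footN ω 0 := by exact_mod_cast hF
    have hn0 : (0 : ℝ) < n := by exact_mod_cast hn
    calc ENNReal.ofReal (wt n (footN ω 0)) / (footN ω 0 : ℝ≥0∞)
        = ENNReal.ofReal (wt n (footN ω 0) / footN ω 0) := by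
          rw [ENNReal.ofReal_div_of_pos hF0, ENNReal.ofReal_natCast]
      _ ≤ ENNReal.ofReal (min (1 / (n : ℝ)) (1 / (footN ω 0 : ℝ))) := ENNReal.ofReal_le_ofReal (wt_div_le' hn hF)
      _ = bwt n (footN ω 0) := by
          rw [ENNReal.ofReal_mono.map_min, one_div, one_div, ENNReal.ofReal_inv_of_pos hn0,
            ENNReal.ofReal_inv_of_pos hF0, ENNReal.ofReal_natCast, ENNReal.ofReal_natCast, bwt]
  · rw [VwH_of_neg (fun h => hf h.2), zero_mul]; exact bot_le

/-- **`(E F)² ≤ 8 V_c / n`** (Cauchy–Schwarz, summation by parts against the second-moment bound, and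
`Σ_t min(1/n², 1/t²) ≤ 2/n`). [cite: Hutchcroft2020Locality, §3, proof of Thm. 1.6] -/
theorem lintegral_F4_sq_le {n : ℕ} (hn : 1 ≤ n) {c : Site 3 → ℝ} {s : Finset (Site 3)}
    (hs : ∀ x ∈ s, x 0 = 0 ∧ x ≠ 0) (hc : ∀ x ∈ s, 0 ≤ c x) :
    (∫⁻ ω, F4 p lam α n c s ω ∂(augWall p lam α)) ^ 2 ≤ ENNReal.ofReal (8 * Vc p lam α c s / n) := by
  classical
  set P := augWall p lam α with hP
  set τ : BondConfig (Site 3) → ℕ := fun ω => if (clusterH ω 0).Finite then footN ω 0 else 0 with hτ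
  set X : BondConfig (Site 3) → ℝ≥0∞ := fun ω =>
    if (clusterH ω 0).Finite then ENNReal.ofReal (Zc p lam α c s ω ^ 2) else 0 with hX
  have hτm : Measurable τ := measurable_ite_nat (measurableSet_finite_clusterH 0) (measurable_footN 0) id 0
  have hXm : Measurable X :=
    Measurable.ite (measurableSet_finite_clusterH 0)
      (ENNReal.measurable_ofReal.comp ((measurable_Zc p lam α c s).pow_const 2)) measurable_const
  have hsq : ∀ ω, F4 p lam α n c s ω ^ 2 = awt n (τ ω) * X ω := by
    intro ω
    by_cases hf : (clusterH ω 0).Finite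
    · simp only [F4, hτ, hX, if_pos hf]
      rw [mul_pow, bwt_sq, ← ENNReal.ofReal_pow (abs_nonneg _), sq_abs]
    · simp only [F4, hτ, hX, if_neg hf]; simp
  have hC : ∀ N : ℕ, ∫⁻ ω, {ω | τ ω ≤ N}.indicator X ω ∂P ≤ ENNReal.ofReal (4 * Vc p lam α c s) * N := by
    intro N
    have heq : ∀ ω, {ω | τ ω ≤ N}.indicator X ω =
        {ω : BondConfig (Site 3) | (clusterH ω 0).Finite ∧ footN ω 0 ≤ N}.indicator
          (fun ω => ENNReal.ofReal (Zc p lam α c s ω ^ 2)) ω := by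
      intro ω
      by_cases hf : (clusterH ω 0).Finite
      · by_cases hN : footN ω 0 ≤ N
        · rw [Set.indicator_of_mem (show ω ∈ {ω | τ ω ≤ N} by simp [hτ, hf, hN]),
            Set.indicator_of_mem (show ω ∈ {ω : BondConfig (Site 3) | (clusterH ω 0).Finite ∧ footN ω 0 ≤ N}
              from ⟨hf, hN⟩)]
          simp [hX, hf]
        · rw [Set.indicator_of_notMem (show ω ∉ {ω | τ ω ≤ N} by simp [hτ, hf, hN]),
            Set.indicator_of_notMem (show ω ∉ {ω : BondConfig (Site 3) | (clusterH ω 0).Finite ∧ footN ω 0 ≤ N}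
              from fun h => hN h.2)]
      · have : X ω = 0 := by simp [hX, hf]
        rw [Set.indicator_of_notMem (show ω ∉ {ω : BondConfig (Site 3) | (clusterH ω 0).Finite ∧ footN ω 0 ≤ N}
          from fun h => hf h.1)]
        by_cases hm : ω ∈ {ω | τ ω ≤ N}
        · rw [Set.indicator_of_mem hm, this]
        · rw [Set.indicator_of_notMem hm]
    calc ∫⁻ ω, {ω | τ ω ≤ N}.indicator X ω ∂P
        = ∫⁻ ω, {ω : BondConfig (Site 3) | (clusterH ω 0).Finite ∧ footN ω 0 ≤ N}.indicator
            (fun ω => ENNReal.ofReal (Zc p lam α c s ω ^ 2)) ω ∂P := lintegral_congr heq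
      _ ≤ ENNReal.ofReal (N * (4 * Vc p lam α c s)) := lintegral_Zc_sq_le p lam α c s hs hc N
      _ = ENNReal.ofReal (4 * Vc p lam α c s) * N := by
          rw [mul_comm (N : ℝ), ENNReal.ofReal_mul (mul_nonneg (by norm_num) (Vc_nonneg p lam α c s)), ENNReal.ofReal_natCast]
  calc (∫⁻ ω, F4 p lam α n c s ω ∂P) ^ 2 ≤ ∫⁻ ω, F4 p lam α n c s ω ^ 2 ∂P :=
        lintegral_sq_le P (measurable_F4 p lam α n c s).aemeasurable
    _ = ∫⁻ ω, awt n (τ ω) * X ω ∂P := lintegral_congr hsq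
    _ ≤ ENNReal.ofReal (4 * Vc p lam α c s) * ∑' t, awt n (t + 1) :=
        lintegral_weight_le P (awt_antitone n) (awt_tendsto_zero n) hXm hτm hC
    _ ≤ ENNReal.ofReal (4 * Vc p lam α c s) * (2 * (n : ℝ≥0∞)⁻¹) := by
        gcongr
        have := tsum_min_inv_sq_le hn
        simpa [awt] using this
    _ = ENNReal.ofReal (8 * Vc p lam α c s / n) := by
        have hn0 : (0 : ℝ) < n := by exact_mod_cast hn
        rw [← ENNReal.ofReal_natCast n, ← ENNReal.ofReal_inv_of_pos hn0, ← ENNReal.ofReal_ofNat,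
          ← ENNReal.ofReal_mul (by norm_num), ← ENNReal.ofReal_mul (mul_nonneg (by norm_num) (Vc_nonneg p lam α c s))]
        congr 1
        field_simp
        ring

end Step4

end WallTwoGhost

open WallTwoGhost in
/-- **K1, part 9 (Lemma 3.1 and the Cauchy–Schwarz step on the wall).** For nonnegative weights `c` on
long wall-bond types `s`, `(E F)² ≤ 8 V_c / n` where `F = 1(C_H(0) finite) min(1/n, 1/F) |Z^c|`
dominates the transported AKN bound `w(F)/F · |Z^c|`. [cite: Hutchcroft2020Locality, §3, proof of Thm. 1.6] -/
theorem wallTwoGhost_cauchy_schwarz : ∀ (p : unitInterval) (lam α : ℝ) (n : ℕ), 1 ≤ n → ∀ (c : Site 3 → ℝ) (s : Finset (Site 3)), (∀ x ∈ s, x 0 = 0 ∧ x ≠ 0) → (∀ x ∈ s, 0 ≤ c x) → (∫⁻ ω, F4 p lam α n c s ω ∂(augWall p lam α)) ^ 2 ≤ ENNReal.ofReal (8 * Vc p lam α c s / n) :=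
  fun p lam α _ hn _ _ hs hc => lintegral_F4_sq_le p lam α hn hs hc

end Summit.CriticalPhenomena.PercolationContinuityZ3.Theorems
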